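import Literature.Barriers.FinalStateConjecture.KleinGordonRealModes
import Literature.Analysis.ODE.JostDecay
import HarnessLib

/-!
# The matching function of the radial Klein–Gordon problem on Kerr: recessive (Jost) solutions
# at infinity, holomorphy, and the horizon/infinity current identity

Topic `Literature/Barriers/FinalStateConjecture` (namespace `Literature.Barriers.FinalStateConjecture`),
continuing `KleinGordonRadialLiouville.lean` / `KleinGordonRealModes.lean`. A mode solution of
Shlapentokh-Rothman (CMP 329 (2014), §2 Def. 2.1) is a horizon-regular solution `y(·; p)` of
`y'' = Q(·; p) y` which is also recessive (exponentially decaying) at infinity; here the recessive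
solutions are the Jost solutions of `Literature/Analysis/ODE/JostDecay.lean` for the frozen coefficient
`w(p) = Q(max(·, R₁); p) − g` (`g > 0` a spectral gap, `γ₀ = √g`, `γ₁ = √g/2`), and modes are the
zeros of the **matching function** `𝔞(p) = W(y_rec(·; p), y(·; p))(R₁ + 1)`. Everything is proved:

* `radHB`, `jostW`: the coefficient functions of the separated form frozen below `R₁` as elements
  of `X = ℝ →ᵇ ℂ` (explicit bounds `radHBound`), `w(p) = Σ gᵢ(p)·Hᵢ − g` polynomial (hence smooth)
  in `p` (`contDiff_jostW`) with `‖w(p)‖ ≤ B_R(1 + r₊)³/(R₁ − r₊) + ‖(σ − ω²) − g‖` (`norm_jostW_le`);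
* `IsMatchRadius`, `IsAdm` (predicates): matching radii `R₁` and admissible parameters, for which
  `‖w(p)‖ < g/2`, `C_K‖w(p)‖ ≤ 2/3` (`jostKconst_gam : C_K = 4/(3g)`, `norm_jostW_lt`);
* `recY`, `recY₁`: the recessive pair; it solves the equation on `(R₁, ∞)` (`isSol2_recY`), decays
  (`norm_recY_le`, `norm_recY₁_le`, `recY_decay`), never vanishes (`recY_ne_zero`), is continuous
  and holomorphic in `p` (`continuousAt_recY`, via `contDiffAt_jostY_param`), and for real parameters
  is real and positive up to a unit (`recY_real`);
* `matchA`: zeros give decaying horizon-regular solutions (`decay_of_matchA_eq_zero`); continuity in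
  `p` (`continuousAt_matchA`, with `continuousAt_radY`) and holomorphy along `C¹` complex curves
  (`differentiableAt_matchA_comp`, with `differentiableAt_radY_comp`);
* **the current identity** `im(𝔞(p) conj(y_rec(t₁) y(t₁))) = (am − 2Mwr₊)‖y_rec(t₁)‖²` for real `p`
  (`im_matchA_mul_conj`), so real zeros of `𝔞` lie at the threshold `am = 2Mwr₊`
  (`am_sub_eq_zero_of_matchA_eq_zero`; SR Thm. 1.3 / §3 in ODE form).

## References
* Y. Shlapentokh-Rothman, Comm. Math. Phys. 329 (2014) 859–891, §2 (2.4)–(2.5), Def. 2.1, §3, §4.3.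
  Key `ShlapentokhRothman2014KleinGordon`.
* P. Hartman, *Ordinary Differential Equations*, SIAM Classics 38 (2002), Ch. X §17, Ch. XI §9. Key `Hartman2002`.
-/

noncomputable section

open Set Filter Metric
open scoped Topology ComplexConjugate ContDiff


namespace Literature.Barriers.FinalStateConjecture

open Literature.Geometry.Lorentzian Literature.Analysis.ODE

/-! ### The frozen coefficient functions as bounded continuous functions -/

section Frozen

variable (M a : ℝ) (m : ℤ)

/-- Uniform bounds `Hᵢ` for the coefficient functions `hᵢ` on `[r₊ + 1, ∞)`. [folklore] -/
def radHBound (i : Fin 5) : ℝ :=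
  ![((1 + Kerr.rPlus M a) ^ 2 + a ^ 2) ^ 2 + a ^ 2, 4 * |M| * |a| * |(m : ℝ)| * (1 + Kerr.rPlus M a), 1,
    (1 + Kerr.rPlus M a) ^ 2, a ^ 2 * (m : ℝ) ^ 2 + horD M a ^ 2 / 4] i

variable {M a m}

/-- `radHBound i ≥ 0`. [folklore] -/
theorem radHBound_nonneg (h : Kerr.IsSubextremal M a) (i : Fin 5) : 0 ≤ radHBound M a m i := by
  have := rPlus_pos_of_isSubextremal h
  fin_cases i <;> simp [radHBound] <;> positivity

/-- **`‖hᵢ(r)‖ ≤ Hᵢ` for `r ≥ r₊ + 1`.** [folklore] -/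
theorem norm_radH_le (h : Kerr.IsSubextremal M a) (i : Fin 5) {r : ℝ} (hr : Kerr.rPlus M a + 1 ≤ r) :
    ‖radH M a m i r‖ ≤ radHBound M a m i := by
  have hrp := rPlus_pos_of_isSubextremal h
  have hr' : Kerr.rPlus M a < r := by linarith
  obtain ⟨hΔx, hrx⟩ := sq_le_delta h hr
  have hΔ := Kerr.delta_pos h.le hr'
  set x := r - Kerr.rPlus M a with hx
  have hx1 : 1 ≤ x := by simp only [hx]; linarith
  have hx0 : 0 ≤ x := by linarith
  have hΔ1 : 1 ≤ Kerr.delta M a r := by nlinarith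
  have hr0 : 0 ≤ r := by linarith
  have hr2 : r ^ 2 ≤ (1 + Kerr.rPlus M a) ^ 2 * Kerr.delta M a r := by
    calc r ^ 2 ≤ ((1 + Kerr.rPlus M a) * x) ^ 2 := by gcongr
      _ = (1 + Kerr.rPlus M a) ^ 2 * x ^ 2 := by ring
      _ ≤ (1 + Kerr.rPlus M a) ^ 2 * Kerr.delta M a r := by gcongr
  have e : ∀ j : Fin 5, ‖radH M a m j r‖ = |radHR M a m j r| := fun j ↦ by
    rw [radH, Complex.norm_real, Real.norm_eq_abs]
  have H0 : ‖radH M a m 0 r‖ ≤ radHBound M a m 0 := by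
    rw [e]
    simp only [radHR, radHBound, Matrix.cons_val_zero]
    rw [abs_div, abs_of_pos (pow_pos hΔ 2), div_le_iff₀ (pow_pos hΔ 2)]
    have h1 : r ^ 2 + a ^ 2 ≤ ((1 + Kerr.rPlus M a) ^ 2 + a ^ 2) * Kerr.delta M a r := by nlinarith
    have h2 : (r ^ 2 + a ^ 2) ^ 2 ≤ ((1 + Kerr.rPlus M a) ^ 2 + a ^ 2) ^ 2 * Kerr.delta M a r ^ 2 := by
      calc (r ^ 2 + a ^ 2) ^ 2 ≤ (((1 + Kerr.rPlus M a) ^ 2 + a ^ 2) * Kerr.delta M a r) ^ 2 := by gcongr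
        _ = _ := by ring
    have h3 : Kerr.delta M a r * a ^ 2 ≤ a ^ 2 * Kerr.delta M a r ^ 2 := by
      nlinarith [mul_nonneg (mul_nonneg (sq_nonneg a) hΔ.le) (sub_nonneg.2 hΔ1)]
    calc |(-(r ^ 2 + a ^ 2) ^ 2 + Kerr.delta M a r * a ^ 2)| ≤ |(-(r ^ 2 + a ^ 2) ^ 2)| + |Kerr.delta M a r * a ^ 2| :=
          abs_add_le _ _
      _ = (r ^ 2 + a ^ 2) ^ 2 + Kerr.delta M a r * a ^ 2 := by
          rw [abs_neg, abs_of_nonneg (by positivity), abs_of_nonneg (by positivity)]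
      _ ≤ _ := by nlinarith
  have H1 : ‖radH M a m 1 r‖ ≤ radHBound M a m 1 := by
    rw [e]
    simp only [radHR, radHBound, Matrix.cons_val_one, Matrix.cons_val_zero]
    rw [abs_div, abs_of_pos (pow_pos hΔ 2), div_le_iff₀ (pow_pos hΔ 2)]
    have h1 : |4 * M * a * (m : ℝ) * r| = 4 * |M| * |a| * |(m : ℝ)| * r := by
      rw [abs_mul, abs_mul, abs_mul, abs_mul, abs_of_nonneg hr0]; norm_num
    rw [h1]
    have h2 : r ≤ (1 + Kerr.rPlus M a) * Kerr.delta M a r ^ 2 := by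
      calc r ≤ (1 + Kerr.rPlus M a) * x := hrx
        _ ≤ (1 + Kerr.rPlus M a) * Kerr.delta M a r ^ 2 := by
            gcongr
            nlinarith
    have h0 : 0 ≤ 4 * |M| * |a| * |(m : ℝ)| := by positivity
    nlinarith
  have H2 : ‖radH M a m 2 r‖ ≤ radHBound M a m 2 := by
    rw [e]
    simp only [radHR, radHBound, Matrix.cons_val_two, Matrix.tail_cons, Matrix.head_cons]
    rw [abs_div, abs_one, abs_of_pos hΔ, div_le_iff₀ hΔ]; linarith
  have H3 : ‖radH M a m 3 r‖ ≤ radHBound M a m 3 := by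
    rw [e]
    simp only [radHR, radHBound, Matrix.cons_val_three, Matrix.tail_cons, Matrix.head_cons]
    rw [abs_div, abs_of_nonneg (sq_nonneg r), abs_of_pos hΔ, div_le_iff₀ hΔ]; exact hr2
  have H4 : ‖radH M a m 4 r‖ ≤ radHBound M a m 4 := by
    rw [e]
    simp only [radHR, radHBound, Matrix.cons_val_four, Matrix.tail_cons, Matrix.head_cons]
    rw [abs_div, abs_of_pos (pow_pos hΔ 2), div_le_iff₀ (pow_pos hΔ 2)]
    have h1 : |(-(a ^ 2 * (m : ℝ) ^ 2) - horD M a ^ 2 / 4)| = a ^ 2 * (m : ℝ) ^ 2 + horD M a ^ 2 / 4 := by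
      rw [show -(a ^ 2 * (m : ℝ) ^ 2) - horD M a ^ 2 / 4 = -(a ^ 2 * (m : ℝ) ^ 2 + horD M a ^ 2 / 4) by ring, abs_neg,
        abs_of_nonneg (by positivity)]
    rw [h1]
    have h0 : 0 ≤ a ^ 2 * (m : ℝ) ^ 2 + horD M a ^ 2 / 4 := by positivity
    have hΔ2 : 1 ≤ Kerr.delta M a r ^ 2 := one_le_pow₀ hΔ1
    nlinarith [mul_nonneg h0 (sub_nonneg.2 hΔ2)]
  fin_cases i
  exacts [H0, H1, H2, H3, H4]

/-- **The frozen coefficient function** `r ↦ hᵢ(max(r, R₁))` as an element of `X = ℝ →ᵇ ℂ`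
(`R₁ ≥ r₊ + 1`). [folklore] -/
def radHB (h : Kerr.IsSubextremal M a) (m : ℤ) {R₁ : ℝ} (hR₁ : Kerr.rPlus M a + 1 ≤ R₁) (i : Fin 5) : BCF :=
  BCF.mk (fun r ↦ radH M a m i (max r R₁))
    ((continuousOn_radH (m := m) h.le i).comp_continuous (continuous_id.max continuous_const) fun r ↦
      lt_of_lt_of_le (by linarith) (le_max_right r R₁))
    (radHBound M a m i) fun r ↦ norm_radH_le h i (hR₁.trans (le_max_right r R₁))

/-- Values of `radHB`. [folklore] -/
@[simp] theorem radHB_apply (h : Kerr.IsSubextremal M a) (m : ℤ) {R₁ : ℝ} (hR₁ : Kerr.rPlus M a + 1 ≤ R₁) (i : Fin 5)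
    (r : ℝ) : radHB h m hR₁ i r = radH M a m i (max r R₁) := rfl

/-- `‖radHB i‖ ≤ Hᵢ`. [folklore] -/
theorem norm_radHB_le (h : Kerr.IsSubextremal M a) (m : ℤ) {R₁ : ℝ} (hR₁ : Kerr.rPlus M a + 1 ≤ R₁) (i : Fin 5) :
    ‖radHB h m hR₁ i‖ ≤ radHBound M a m i :=
  BCF.norm_mk_le (radHBound_nonneg h i) _

/-- **The frozen, shifted coefficient** `w(p) = Σᵢ gᵢ(p) · Hᵢ − g · 1 ∈ X`, so that
`w(p)(r) = Q(max(r, R₁); p) − g`. [folklore] -/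
def jostW (h : Kerr.IsSubextremal M a) (m : ℤ) {R₁ : ℝ} (hR₁ : Kerr.rPlus M a + 1 ≤ R₁) (g : ℝ) (p : ℂ × ℂ × ℂ) : BCF :=
  ∑ i, radMon i p • radHB h m hR₁ i - BoundedContinuousFunction.const ℝ ((g : ℝ) : ℂ)

/-- Values of `w(p)`: `w(p)(r) = Q(max(r, R₁); p) − g`. [folklore] -/
theorem jostW_apply (h : Kerr.IsSubextremal M a) (m : ℤ) {R₁ : ℝ} (hR₁ : Kerr.rPlus M a + 1 ≤ R₁) (g : ℝ)
    (p : ℂ × ℂ × ℂ) (r : ℝ) : jostW h m hR₁ g p r = radQ M a m p (max r R₁) - g := by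
  have hr : Kerr.rPlus M a < max r R₁ := lt_of_lt_of_le (by linarith) (le_max_right r R₁)
  rw [radQ_eq_sum h.le p hr, jostW]
  simp only [BoundedContinuousFunction.coe_sub, Pi.sub_apply, BoundedContinuousFunction.coe_sum, Finset.sum_apply,
    BoundedContinuousFunction.coe_smul, radHB_apply, smul_eq_mul, BoundedContinuousFunction.const_apply]

/-- `p ↦ w(p)` is smooth (indeed polynomial) as an `X`-valued map. [folklore] -/
theorem contDiff_jostW (h : Kerr.IsSubextremal M a) (m : ℤ) {R₁ : ℝ} (hR₁ : Kerr.rPlus M a + 1 ≤ R₁) (g : ℝ)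
    {n : WithTop ℕ∞} : ContDiff ℂ n (jostW h m hR₁ g) := by
  unfold jostW
  refine ContDiff.sub (ContDiff.sum fun i _ ↦ ?_) contDiff_const
  exact ((contDiff_radMon i).of_le le_top).smul contDiff_const

/-- **The size of `w(p)`**: for `p` in the box of size `R` and `R₁` beyond the asymptotic threshold,
`‖w(p)‖ ≤ B_R (1 + r₊)³/(R₁ − r₊) + ‖(σ − ω²) − g‖`. [folklore] -/
theorem norm_jostW_le (h : Kerr.IsSubextremal M a) (m : ℤ) {R₁ : ℝ} (hR₁ : Kerr.rPlus M a + 1 ≤ R₁) (g : ℝ) {R : ℝ}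
    (hR : 0 ≤ R) {p : ℂ × ℂ × ℂ} (hp : p ∈ horBoxClosed R) :
    ‖jostW h m hR₁ g p‖ ≤ radNBound M a m R * (1 + Kerr.rPlus M a) ^ 3 / (R₁ - Kerr.rPlus M a) + ‖(p.2.2 - p.1 ^ 2) - g‖ := by
  have hrp := rPlus_pos_of_isSubextremal h
  have hB : 0 ≤ radNBound M a m R * (1 + Kerr.rPlus M a) ^ 3 := by
    have := radNBound_nonneg (M := M) (a := a) (m := m) hR; positivity
  have h0 : 0 ≤ radNBound M a m R * (1 + Kerr.rPlus M a) ^ 3 / (R₁ - Kerr.rPlus M a) + ‖(p.2.2 - p.1 ^ 2) - g‖ := by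
    have : 0 ≤ radNBound M a m R * (1 + Kerr.rPlus M a) ^ 3 / (R₁ - Kerr.rPlus M a) := div_nonneg hB (by linarith)
    positivity
  refine (BoundedContinuousFunction.norm_le h0).2 fun r ↦ ?_
  rw [jostW_apply]
  have hr1 : Kerr.rPlus M a + 1 ≤ max r R₁ := hR₁.trans (le_max_right r R₁)
  have hb := norm_radQ_sub_le (m := m) h hR hp hr1
  have hmono : radNBound M a m R * (1 + Kerr.rPlus M a) ^ 3 / (max r R₁ - Kerr.rPlus M a) ≤
      radNBound M a m R * (1 + Kerr.rPlus M a) ^ 3 / (R₁ - Kerr.rPlus M a) := by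
    apply div_le_div_of_nonneg_left hB (by linarith) (by linarith [le_max_right r R₁])
  calc ‖radQ M a m p (max r R₁) - g‖ = ‖(radQ M a m p (max r R₁) - (p.2.2 - p.1 ^ 2)) + ((p.2.2 - p.1 ^ 2) - g)‖ := by
        ring_nf
    _ ≤ ‖radQ M a m p (max r R₁) - (p.2.2 - p.1 ^ 2)‖ + ‖(p.2.2 - p.1 ^ 2) - g‖ := norm_add_le _ _
    _ ≤ _ := by linarith

end Frozen

/-! ### The recessive family at infinity (Jost solutions) -/

section Recessive

variable {M a : ℝ} {m : ℤ}

/-- `γ₀ = √g`. [folklore] -/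
def gam0 (g : ℝ) : ℂ := (Real.sqrt g : ℂ)

/-- `γ₁ = √g/2`. [folklore] -/
def gam1 (g : ℝ) : ℝ := Real.sqrt g / 2

/-- `0 ≤ γ₁`. [folklore] -/
theorem gam1_nonneg (g : ℝ) : 0 ≤ gam1 g := by unfold gam1; positivity

/-- `γ₁ < re γ₀` for `g > 0`. [folklore] -/
theorem gam1_lt {g : ℝ} (hg : 0 < g) : gam1 g < (gam0 g).re := by
  simp only [gam1, gam0, Complex.ofReal_re]
  have := Real.sqrt_pos.2 hg; linarith

/-- `γ₀² = g`. [folklore] -/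
theorem gam0_sq {g : ℝ} (hg : 0 ≤ g) : gam0 g ^ 2 = (g : ℂ) := by
  rw [gam0, ← Complex.ofReal_pow, Real.sq_sqrt hg]

/-- The Green-operator constant: `C_K = 4/(3g)`. [folklore] -/
theorem jostKconst_gam {g : ℝ} (hg : 0 < g) : jostKconst (gam0 g) (gam1 g) = 4 / (3 * g) := by
  have hs := Real.sqrt_pos.2 hg
  have hs2 : Real.sqrt g * Real.sqrt g = g := Real.mul_self_sqrt hg.le
  simp only [jostKconst, gam0, gam1, Complex.norm_real, Real.norm_eq_abs, abs_of_pos hs, Complex.ofReal_re]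
  field_simp
  nlinarith [hs2]

variable (M a m) in
/-- **The recessive (exponentially decaying) solution** `y_rec(r; p)` of `y'' = Q(·; p) y` on
`(R₁, ∞)`, holomorphic in `p`: the Jost solution of `JostDecay.lean` for the frozen coefficient
`w(p) = Q(max(·, R₁); p) − g`, `γ₀ = √g`, `γ₁ = √g/2`.
[cite: ShlapentokhRothman2014KleinGordon, §2 (2.4)–(2.5) and Lemma 4.5] -/
def recY (h : Kerr.IsSubextremal M a) {R₁ : ℝ} (hR₁ : Kerr.rPlus M a + 1 ≤ R₁) {g : ℝ} (hg : 0 < g)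
    (p : ℂ × ℂ × ℂ) (r : ℝ) : ℂ :=
  jostY (gam1_nonneg g) (gam1_lt hg) R₁ (jostW h m hR₁ g p) r

variable (M a m) in
/-- Its derivative `y_rec'(r; p)`. [folklore] -/
def recY₁ (h : Kerr.IsSubextremal M a) {R₁ : ℝ} (hR₁ : Kerr.rPlus M a + 1 ≤ R₁) {g : ℝ} (hg : 0 < g)
    (p : ℂ × ℂ × ℂ) (r : ℝ) : ℂ :=
  jostYder (gam1_nonneg g) (gam1_lt hg) R₁ (w := jostW h m hR₁ g p) r

/-- **Admissible parameters**: `p` in the box of size `R` with `‖(σ − ω²) − g‖ < 3g/8`. [folklore] -/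
def IsAdm (R g : ℝ) (p : ℂ × ℂ × ℂ) : Prop := p ∈ horBoxClosed R ∧ ‖(p.2.2 - p.1 ^ 2) - g‖ < 3 * g / 8

/-- **A matching radius**: `R₁ ≥ r₊ + 1` beyond the asymptotic threshold for `γ² = g/4` and with
`B_R(1 + r₊)³/(R₁ − r₊) ≤ g/8`. [folklore] -/
def IsMatchRadius (M a : ℝ) (m : ℤ) (R g R₁ : ℝ) : Prop :=
  Kerr.rPlus M a + 1 + radNBound M a m R * (1 + Kerr.rPlus M a) ^ 3 / (g / 4) ≤ R₁ ∧
    radNBound M a m R * (1 + Kerr.rPlus M a) ^ 3 / (R₁ - Kerr.rPlus M a) ≤ g / 8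

/-- Matching radii exist. [folklore] -/
theorem exists_isMatchRadius (h : Kerr.IsSubextremal M a) {R g : ℝ} (hR : 0 ≤ R) (hg : 0 < g) :
    ∃ R₁, IsMatchRadius M a m R g R₁ := by
  have hrp := rPlus_pos_of_isSubextremal h
  set B := radNBound M a m R * (1 + Kerr.rPlus M a) ^ 3 with hB
  have hB0 : 0 ≤ B := by have := radNBound_nonneg (M := M) (a := a) (m := m) hR; positivity
  refine ⟨Kerr.rPlus M a + 1 + B / (g / 4) + B / (g / 8), ?_, ?_⟩
  · have : 0 ≤ B / (g / 8) := by positivity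
    linarith
  · have h1 : 0 < 1 + B / (g / 4) + B / (g / 8) := by positivity
    rw [show Kerr.rPlus M a + 1 + B / (g / 4) + B / (g / 8) - Kerr.rPlus M a = 1 + B / (g / 4) + B / (g / 8) by ring,
      div_le_iff₀ h1]
    have h2 : B = g / 8 * (B / (g / 8)) := by field_simp
    have h3 : 0 ≤ B / (g / 4) := by positivity
    calc B = g / 8 * (B / (g / 8)) := h2
      _ ≤ g / 8 * (1 + B / (g / 4) + B / (g / 8)) := by gcongr; linarith

/-- A matching radius is `≥ r₊ + 1`. [folklore] -/
theorem IsMatchRadius.le {R g R₁ : ℝ} (hM : IsMatchRadius M a m R g R₁) (h : Kerr.IsSubextremal M a) (hR : 0 ≤ R)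
    (hg : 0 < g) : Kerr.rPlus M a + 1 ≤ R₁ := by
  have hrp := rPlus_pos_of_isSubextremal h
  have : 0 ≤ radNBound M a m R * (1 + Kerr.rPlus M a) ^ 3 / (g / 4) := by
    have := radNBound_nonneg (M := M) (a := a) (m := m) hR; positivity
  linarith [hM.1]

section Setup

variable (h : Kerr.IsSubextremal M a) {R g R₁ : ℝ} (hR : 0 ≤ R) (hg : 0 < g) (hM : IsMatchRadius M a m R g R₁)
  {p : ℂ × ℂ × ℂ} (hp : IsAdm R g p)
include h hR hg hM hp

/-- **Smallness of `w(p)`** for admissible `p`: `‖w(p)‖ < g/2`, hence `C_K‖w(p)‖ ≤ 2/3 < 1`.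
[folklore] -/
theorem norm_jostW_lt : ‖jostW h m (hM.le h hR hg) g p‖ < g / 2 ∧
    jostKconst (gam0 g) (gam1 g) * ‖jostW h m (hM.le h hR hg) g p‖ < 1 ∧
    1 / (1 - jostKconst (gam0 g) (gam1 g) * ‖jostW h m (hM.le h hR hg) g p‖) ≤ 3 := by
  have h1 := norm_jostW_le h m (hM.le h hR hg) g hR hp.1
  have h2 : ‖jostW h m (hM.le h hR hg) g p‖ < g / 2 := by linarith [hM.2, hp.2]
  rw [jostKconst_gam hg]
  have h3 : 4 / (3 * g) * ‖jostW h m (hM.le h hR hg) g p‖ ≤ 2 / 3 := by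
    rw [div_mul_eq_mul_div, div_le_iff₀ (by positivity)]; linarith
  refine ⟨h2, by linarith, ?_⟩
  rw [div_le_iff₀ (by linarith)]; linarith

/-- The far-field bounds at admissible parameters: `re Q ≥ g/4` and `‖Q‖ ≤ 2R² + R + g/4` on
`[R₁, ∞)`. [folklore] -/
theorem re_radQ_ge_of_isAdm {t : ℝ} (ht : R₁ ≤ t) : g / 4 ≤ (radQ M a m p t).re ∧ ‖radQ M a m p t‖ ≤ R + R ^ 2 + g / 4 := by
  set γ := Real.sqrt (g / 4) with hγ
  have hγ0 : 0 < γ := Real.sqrt_pos.2 (by positivity)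
  have hγ2 : γ ^ 2 = g / 4 := Real.sq_sqrt (by positivity)
  have hre : 2 * γ ^ 2 ≤ (p.2.2 - p.1 ^ 2).re := by
    rw [hγ2]
    have h1 : |((p.2.2 - p.1 ^ 2) - g).re| ≤ ‖(p.2.2 - p.1 ^ 2) - (g : ℂ)‖ := Complex.abs_re_le_norm _
    rw [Complex.sub_re, Complex.ofReal_re] at h1
    have := (abs_le.1 (h1.trans hp.2.le)).1
    linarith
  have ht' : Kerr.rPlus M a + 1 + radNBound M a m R * (1 + Kerr.rPlus M a) ^ 3 / γ ^ 2 ≤ t := by rw [hγ2]; exact hM.1.trans ht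
  obtain ⟨h1, h2⟩ := re_radQ_ge (m := m) h hR hp.1 hγ0 hre ht'
  rw [hγ2] at h1 h2
  refine ⟨h1, h2.trans ?_⟩
  have : ‖p.2.2 - p.1 ^ 2‖ ≤ R + R ^ 2 := by
    refine (norm_sub_le _ _).trans ?_
    rw [norm_pow]
    have := hp.1.1; have := hp.1.2.2
    nlinarith [norm_nonneg p.1]
  linarith

/-- **`y_rec` solves `y'' = Q(·; p) y` on `(R₁, ∞)`.** [cite: Hartman2002, Ch. X §17] -/
theorem isSol2_recY : IsSol2 (radQ M a m p) (recY M a m h (hM.le h hR hg) hg p) (recY₁ M a m h (hM.le h hR hg) hg p) (Ioi R₁) := by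
  obtain ⟨-, hw, -⟩ := norm_jostW_lt h hR hg hM hp
  refine ⟨fun r hr ↦ hasDerivAt_jostY _ _ R₁ hw hr, fun r hr ↦ ?_⟩
  have h1 := hasDerivAt_jostYder (gam1_nonneg g) (gam1_lt hg) R₁ hw hr
  refine h1.congr_deriv ?_
  rw [gam0_sq hg.le, jostW_apply, max_eq_left (le_of_lt hr)]
  simp only [recY]
  ring

/-- **Decay of `y_rec`**: `‖y_rec(r; p)‖ ≤ 3 e^{−γ₁(r−R₁)}`. [cite: Hartman2002, Ch. X §17] -/
theorem norm_recY_le (r : ℝ) : ‖recY M a m h (hM.le h hR hg) hg p r‖ ≤ 3 * Real.exp (-(gam1 g * (r - R₁))) := by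
  obtain ⟨-, hw, h3⟩ := norm_jostW_lt h hR hg hM hp
  have h1 := norm_jostY_le (gam1_nonneg g) (gam1_lt hg) R₁ hw r
  rw [recY]
  refine h1.trans ?_
  rw [mul_comm]
  gcongr

/-- **Decay of `y_rec'`**: `‖y_rec'(r; p)‖ ≤ 3√g e^{−γ₁(r−R₁)}` for `r ≥ R₁`. [cite: Hartman2002, Ch. X §17] -/
theorem norm_recY₁_le {r : ℝ} (hr : R₁ ≤ r) :
    ‖recY₁ M a m h (hM.le h hR hg) hg p r‖ ≤ 3 * Real.sqrt g * Real.exp (-(gam1 g * (r - R₁))) := by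
  obtain ⟨hw2, hw, h3⟩ := norm_jostW_lt h hR hg hM hp
  have h1 := norm_jostYder_le (gam1_nonneg g) (gam1_lt hg) R₁ hw hr
  rw [recY₁]
  refine h1.trans ?_
  have hs := Real.sqrt_pos.2 hg
  have hK : ‖gam0 g‖ + 1 / 2 * (1 / ((gam0 g).re - gam1 g) + 1 / ((gam0 g).re + gam1 g)) *
      (‖jostW h m (hM.le h hR hg) g p‖ * (1 / (1 - jostKconst (gam0 g) (gam1 g) * ‖jostW h m (hM.le h hR hg) g p‖))) ≤
      3 * Real.sqrt g := by
    have e1 : ‖gam0 g‖ = Real.sqrt g := by simp [gam0, Complex.norm_real, Real.norm_eq_abs, abs_of_pos hs]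
    have e2 : 1 / ((gam0 g).re - gam1 g) + 1 / ((gam0 g).re + gam1 g) = 8 / (3 * Real.sqrt g) := by
      simp only [gam0, gam1, Complex.ofReal_re]; field_simp; ring
    rw [e1, e2]
    have hprod : ‖jostW h m (hM.le h hR hg) g p‖ * (1 / (1 - jostKconst (gam0 g) (gam1 g) * ‖jostW h m (hM.le h hR hg) g p‖)) ≤
        g / 2 * 3 := mul_le_mul hw2.le h3 (by
          have : jostKconst (gam0 g) (gam1 g) * ‖jostW h m (hM.le h hR hg) g p‖ < 1 := hw
          have : 0 < 1 - jostKconst (gam0 g) (gam1 g) * ‖jostW h m (hM.le h hR hg) g p‖ := by linarith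
          positivity) (by positivity)
    have hs2 : Real.sqrt g * Real.sqrt g = g := Real.mul_self_sqrt hg.le
    calc Real.sqrt g + 1 / 2 * (8 / (3 * Real.sqrt g)) * (‖jostW h m (hM.le h hR hg) g p‖ *
          (1 / (1 - jostKconst (gam0 g) (gam1 g) * ‖jostW h m (hM.le h hR hg) g p‖)))
        ≤ Real.sqrt g + 1 / 2 * (8 / (3 * Real.sqrt g)) * (g / 2 * 3) := by gcongr
      _ = 3 * Real.sqrt g := by field_simp; nlinarith [hs2]
  calc Real.exp (-(gam1 g * (r - R₁))) * (‖gam0 g‖ + 1 / 2 * (1 / ((gam0 g).re - gam1 g) + 1 / ((gam0 g).re + gam1 g)) *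
        (‖jostW h m (hM.le h hR hg) g p‖ * (1 / (1 - jostKconst (gam0 g) (gam1 g) * ‖jostW h m (hM.le h hR hg) g p‖))))
      ≤ Real.exp (-(gam1 g * (r - R₁))) * (3 * Real.sqrt g) := by gcongr
    _ = _ := by ring

/-- `y_rec` is not identically zero. [folklore] -/
theorem exists_recY_ne_zero : ∃ r, R₁ < r ∧ recY M a m h (hM.le h hR hg) hg p r ≠ 0 :=
  exists_jostY_ne_zero (gam1_nonneg g) (gam1_lt hg) R₁ (norm_jostW_lt h hR hg hM hp).2.1

/-- **`y_rec` never vanishes on `(R₁, ∞)`** (a bounded solution with `re Q ≥ γ² > 0` has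
`‖y(t)‖² ≤ ‖y(t₁)‖² e^{−√2γ(t−t₁)}`; a zero at `t₁` would make it vanish beyond `t₁`, hence
identically). [folklore] -/
theorem recY_ne_zero {t : ℝ} (ht : R₁ < t) : recY M a m h (hM.le h hR hg) hg p t ≠ 0 := by
  intro h0
  have hsol := isSol2_recY h hR hg hM hp
  set γ := Real.sqrt (g / 4) with hγ
  have hγ0 : 0 < γ := Real.sqrt_pos.2 (by positivity)
  have hγ2 : γ ^ 2 = g / 4 := Real.sq_sqrt (by positivity)
  have hQ : ∀ s, t ≤ s → γ ^ 2 ≤ RCLike.re (radQ M a m p s) := fun s hs ↦ by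
    rw [hγ2]; exact (re_radQ_ge_of_isAdm h hR hg hM hp (ht.le.trans hs)).1
  have hbd : ∀ s, t ≤ s → ‖recY M a m h (hM.le h hR hg) hg p s‖ ≤ 3 := fun s hs ↦
    (norm_recY_le h hR hg hM hp s).trans (by
      have : Real.exp (-(gam1 g * (s - R₁))) ≤ 1 := by
        rw [Real.exp_le_one_iff]; have := gam1_nonneg g; nlinarith [ht.le.trans hs]
      linarith)
  have hE := hsol.solEnergy_nonpos_of_bounded ht hγ0 hQ hbd
  -- vanishing beyond `t`
  have hzero : ∀ s, t ≤ s → recY M a m h (hM.le h hR hg) hg p s = 0 := by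
    intro s hs
    have h1 := hsol.normSq_le_of_solEnergy_nonpos ht hE le_rfl hs
    rw [h0, norm_zero] at h1
    have : ‖recY M a m h (hM.le h hR hg) hg p s‖ ^ 2 ≤ 0 := by simpa using h1
    exact norm_eq_zero.1 (by nlinarith [norm_nonneg (recY M a m h (hM.le h hR hg) hg p s)])
  -- the derivative vanishes at `t + 1` too, so `y ≡ 0` on `(R₁, ∞)`
  have hd0 : recY₁ M a m h (hM.le h hR hg) hg p (t + 1) = 0 := by
    have hd := hsol.hasDerivAt (t + 1) (by simp; linarith)
    have hev : recY M a m h (hM.le h hR hg) hg p =ᶠ[𝓝 (t + 1)] fun _ ↦ 0 := by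
      filter_upwards [Ioi_mem_nhds (show t < t + 1 by linarith)] with s hs using hzero s hs.le
    have h2 : HasDerivAt (recY M a m h (hM.le h hR hg) hg p) 0 (t + 1) :=
      (hasDerivAt_const (t + 1) (0 : ℂ)).congr_of_eventuallyEq hev
    exact hd.unique h2
  have hR₁r : Kerr.rPlus M a < R₁ := by linarith [hM.le h hR hg]
  obtain ⟨heq, -⟩ := hsol.eqOn_zero ((continuousOn_radQ h.le p).mono fun s hs ↦ hR₁r.trans hs)
    (show R₁ < t + 1 by linarith) (hzero (t + 1) (by linarith)) hd0
  obtain ⟨r, hr, hne⟩ := exists_recY_ne_zero h hR hg hM hp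
  exact hne (heq hr)

end Setup

end Recessive


section MatchFn

variable {M a : ℝ} {m : ℤ}

/-! ### Decay in the standard form and reality of the recessive solution -/

section Setup2

variable (h : Kerr.IsSubextremal M a) {R g R₁ : ℝ} (hR : 0 ≤ R) (hg : 0 < g) (hM : IsMatchRadius M a m R g R₁)
  {p : ℂ × ℂ × ℂ} (hp : IsAdm R g p)
include h hR hg hM hp

/-- **Decay of the recessive pair in standard form**: `‖y_rec‖, ‖y_rec'‖ ≤ C e^{−γ₁ t}` on `[R₁, ∞)`
with `C = 3(1 + √g) e^{γ₁ R₁}`. [folklore] -/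
theorem recY_decay {t : ℝ} (ht : R₁ ≤ t) :
    ‖recY M a m h (hM.le h hR hg) hg p t‖ ≤ 3 * (1 + Real.sqrt g) * Real.exp (gam1 g * R₁) * Real.exp (-(gam1 g * t)) ∧
      ‖recY₁ M a m h (hM.le h hR hg) hg p t‖ ≤ 3 * (1 + Real.sqrt g) * Real.exp (gam1 g * R₁) * Real.exp (-(gam1 g * t)) := by
  have e : Real.exp (-(gam1 g * (t - R₁))) = Real.exp (gam1 g * R₁) * Real.exp (-(gam1 g * t)) := by
    rw [← Real.exp_add]; congr 1; ring
  have h1 := norm_recY_le h hR hg hM hp t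
  have h2 := norm_recY₁_le h hR hg hM hp ht
  rw [e] at h1 h2
  have hs : 0 ≤ Real.sqrt g := Real.sqrt_nonneg _
  have hE : 0 ≤ Real.exp (gam1 g * R₁) * Real.exp (-(gam1 g * t)) := by positivity
  constructor
  · refine h1.trans ?_
    have : (3 : ℝ) ≤ 3 * (1 + Real.sqrt g) := by nlinarith
    calc 3 * (Real.exp (gam1 g * R₁) * Real.exp (-(gam1 g * t))) ≤ 3 * (1 + Real.sqrt g) *
        (Real.exp (gam1 g * R₁) * Real.exp (-(gam1 g * t))) := by gcongr
      _ = _ := by ring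
  · refine h2.trans ?_
    have : 3 * Real.sqrt g ≤ 3 * (1 + Real.sqrt g) := by linarith
    calc 3 * Real.sqrt g * (Real.exp (gam1 g * R₁) * Real.exp (-(gam1 g * t))) ≤ 3 * (1 + Real.sqrt g) *
        (Real.exp (gam1 g * R₁) * Real.exp (-(gam1 g * t))) := by gcongr
      _ = _ := by ring

end Setup2

/-- **Reality of the recessive solution at real parameters, up to a unit**: for real admissible
`p = (w, Λ, σ)`, with `u = y_rec(R₁+1)/‖y_rec(R₁+1)‖`, the functions `conj u · y_rec` and
`conj u · y_rec'` are real on `(R₁, ∞)`, and `conj u · y_rec > 0` there. (`W(y_rec, ȳ_rec)` is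
constant — same real equation — and tends to `0`, so `ȳ_rec = c y_rec`; a non-vanishing real
solution has constant sign.) [folklore] -/
theorem recY_real (h : Kerr.IsSubextremal M a) {R g R₁ : ℝ} (hR : 0 ≤ R) (hg : 0 < g) (hM : IsMatchRadius M a m R g R₁)
    (w Λ σ : ℝ) (hp : IsAdm R g ((w : ℂ), (Λ : ℂ), (σ : ℂ))) :
    let p : ℂ × ℂ × ℂ := ((w : ℂ), (Λ : ℂ), (σ : ℂ))
    let u : ℂ := recY M a m h (hM.le h hR hg) hg p (R₁ + 1) / (‖recY M a m h (hM.le h hR hg) hg p (R₁ + 1)‖ : ℂ)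
    ‖u‖ = 1 ∧ ∀ t ∈ Ioi R₁, (conj u * recY M a m h (hM.le h hR hg) hg p t).im = 0 ∧
      (conj u * recY₁ M a m h (hM.le h hR hg) hg p t).im = 0 ∧ 0 < (conj u * recY M a m h (hM.le h hR hg) hg p t).re := by
  intro p u
  set y := recY M a m h (hM.le h hR hg) hg p with hy
  set y₁ := recY₁ M a m h (hM.le h hR hg) hg p with hy₁
  have hsol : IsSol2 (radQ M a m p) y y₁ (Ioi R₁) := isSol2_recY h hR hg hM hp
  have hR₁r : Kerr.rPlus M a < R₁ := by linarith [hM.le h hR hg]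
  have hQc : ContinuousOn (radQ M a m p) (Ioi R₁) := (continuousOn_radQ h.le p).mono fun s hs ↦ hR₁r.trans hs
  have hne : ∀ t ∈ Ioi R₁, y t ≠ 0 := fun t ht ↦ recY_ne_zero h hR hg hM hp ht
  set t₁ := R₁ + 1 with ht₁
  have ht₁m : t₁ ∈ Ioi R₁ := by simp only [ht₁, mem_Ioi]; linarith
  have hy₁ne : y t₁ ≠ 0 := hne t₁ ht₁m
  have hnorm : (0 : ℝ) < ‖y t₁‖ := norm_pos_iff.2 hy₁ne
  have hu : ‖u‖ = 1 := by
    have : ‖u‖ = ‖y t₁‖ / |‖y t₁‖| := by simp only [u, norm_div, Complex.norm_real, Real.norm_eq_abs, ← hy, ht₁]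
    rw [this, abs_norm, div_self hnorm.ne']
  -- the conjugate pair solves the same (real) equation
  have hsolc : IsSol2 (radQ M a m p) (fun t ↦ conj (y t)) (fun t ↦ conj (y₁ t)) (Ioi R₁) := by
    have hc := isSol2_conj hsol
    have hQ : (fun t ↦ conj (radQ M a m p t)) = radQ M a m p := funext fun t ↦ conj_radQ_ofReal w Λ σ t
    rwa [hQ] at hc
  -- `W(y, ȳ)` is constant and tends to `0`, hence vanishes
  have hWlim : Tendsto (wronskian y y₁ (fun t ↦ conj (y t)) (fun t ↦ conj (y₁ t))) atTop (𝓝 0) := by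
    have hpos : 0 < gam1 g + gam1 g := by have := gam1_lt hg; simp [gam0] at this; unfold gam1; positivity
    refine tendsto_wronskian_zero_of_decay (T := R₁) (C' := 3 * (1 + Real.sqrt g) * Real.exp (gam1 g * R₁)) hpos
      (fun t ht ↦ recY_decay h hR hg hM hp ht) fun t ht ↦ ?_
    obtain ⟨d0, d1⟩ := recY_decay h hR hg hM hp ht
    exact ⟨by rw [Complex.norm_conj]; exact d0, by rw [Complex.norm_conj]; exact d1⟩
  have hWconst : ∀ t ∈ Ioi R₁, wronskian y y₁ (fun t ↦ conj (y t)) (fun t ↦ conj (y₁ t)) t =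
      wronskian y y₁ (fun t ↦ conj (y t)) (fun t ↦ conj (y₁ t)) t₁ := fun t ht ↦ hsol.wronskian_eq hsolc ht ht₁m
  have hW0 : wronskian y y₁ (fun t ↦ conj (y t)) (fun t ↦ conj (y₁ t)) t₁ = 0 := by
    have hlim2 : Tendsto (wronskian y y₁ (fun t ↦ conj (y t)) (fun t ↦ conj (y₁ t))) atTop
        (𝓝 (wronskian y y₁ (fun t ↦ conj (y t)) (fun t ↦ conj (y₁ t)) t₁)) := by
      refine (tendsto_const_nhds).congr' ?_
      filter_upwards [eventually_gt_atTop R₁] with t ht using (hWconst t ht).symm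
    exact tendsto_nhds_unique hlim2 hWlim
  obtain ⟨c, hc, hc'⟩ := hsol.exists_eq_smul_of_wronskian_eq_zero hQc hsolc ht₁m hW0 (Or.inl hy₁ne)
  -- `c = conj (y t₁) / y t₁`, and `conj u · y` is real
  have hcval : c = conj (y t₁) / y t₁ := by
    have := hc ht₁m; simp only at this
    rw [eq_div_iff hy₁ne]; exact this.symm
  have hreal : ∀ z : ℂ, conj z = c * z → (conj u * z).im = 0 := by
    intro z hz
    apply Complex.conj_eq_iff_im.1
    rw [map_mul, Complex.conj_conj, hz, hcval]
    simp only [u, map_div₀, Complex.conj_ofReal]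
    field_simp
    ring
  have him : ∀ t ∈ Ioi R₁, (conj u * y t).im = 0 ∧ (conj u * y₁ t).im = 0 := fun t ht ↦
    ⟨hreal _ (hc ht), hreal _ (hc' ht)⟩
  -- positivity of the real part: non-vanishing + value `‖y t₁‖ > 0` at `t₁` + intermediate values
  have hre1 : (conj u * y t₁).re = ‖y t₁‖ := by
    have : conj u * y t₁ = (‖y t₁‖ : ℂ) := by
      have hn0 : ((‖y t₁‖ : ℝ) : ℂ) ≠ 0 := by exact_mod_cast hnorm.ne'
      have e : conj (y t₁) * y t₁ = ((‖y t₁‖ ^ 2 : ℝ) : ℂ) := by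
        rw [mul_comm, Complex.mul_conj, Complex.normSq_eq_norm_sq]
      simp only [u, map_div₀, Complex.conj_ofReal, ← hy]
      rw [div_mul_eq_mul_div, e, div_eq_iff hn0]
      push_cast; ring
    rw [this, Complex.ofReal_re]
  have hcont : ContinuousOn (fun t ↦ (conj u * y t).re) (Ioi R₁) :=
    Complex.continuous_re.comp_continuousOn (continuousOn_const.mul hsol.continuousOn.1)
  have hnz : ∀ t ∈ Ioi R₁, (conj u * y t).re ≠ 0 := by
    intro t ht h0
    have hz : conj u * y t = 0 := Complex.ext (by simpa using h0) (by simpa using (him t ht).1)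
    rcases mul_eq_zero.1 hz with h1 | h1
    · rw [map_eq_zero] at h1; rw [h1, norm_zero] at hu; exact zero_ne_one hu
    · exact hne t ht h1
  refine ⟨hu, fun t ht ↦ ⟨(him t ht).1, (him t ht).2, ?_⟩⟩
  by_contra hle
  push Not at hle
  have hlt : (conj u * y t).re < 0 := lt_of_le_of_ne hle (hnz t ht)
  have hpos1 : 0 < (conj u * y t₁).re := by rw [hre1]; exact hnorm
  -- intermediate value on the interval between `t` and `t₁`
  rcases le_total t t₁ with htt | htt
  · have hc' : ContinuousOn (fun t ↦ (conj u * y t).re) (Icc t t₁) := hcont.mono fun s hs ↦ lt_of_lt_of_le ht hs.1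
    obtain ⟨s, hs, hs0⟩ := intermediate_value_Icc htt hc' ⟨hlt.le, hpos1.le⟩
    exact hnz s (lt_of_lt_of_le ht hs.1) hs0
  · have hc' : ContinuousOn (fun t ↦ (conj u * y t).re) (Icc t₁ t) := hcont.mono fun s hs ↦ lt_of_lt_of_le ht₁m hs.1
    obtain ⟨s, hs, hs0⟩ := intermediate_value_Icc' htt hc' ⟨hlt.le, hpos1.le⟩
    exact hnz s (lt_of_lt_of_le ht₁m hs.1) hs0

/-! ### The matching function -/

variable (M a m) in
/-- **The matching function** `𝔞(p) = W(y_rec(·; p), y(·; p))(R₁ + 1)`: its zeros are the mode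
solutions (horizon-regular AND recessive at infinity). [cite: ShlapentokhRothman2014KleinGordon, §4.3] -/
def matchA (h : Kerr.IsSubextremal M a) {R₁ : ℝ} (hR₁ : Kerr.rPlus M a + 1 ≤ R₁) {g : ℝ} (hg : 0 < g)
    (p : ℂ × ℂ × ℂ) : ℂ :=
  wronskian (recY M a m h hR₁ hg p) (recY₁ M a m h hR₁ hg p) (radY M a m p) (radY₁ M a m p) (R₁ + 1)

/-- **A zero of `𝔞` gives a decaying horizon-regular solution**: if `𝔞(p) = 0` then
`y(·; p) = c · y_rec(·; p)` on `(R₁, ∞)`, so `‖y‖, ‖y'‖ ≤ C e^{−γ₁ t}` there.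
[cite: ShlapentokhRothman2014KleinGordon, §2 Def. 2.1 and (2.4)] -/
theorem decay_of_matchA_eq_zero (h : Kerr.IsSubextremal M a) {R g R₁ : ℝ} (hR : 0 ≤ R) (hg : 0 < g)
    (hM : IsMatchRadius M a m R g R₁) {p : ℂ × ℂ × ℂ} (hp : IsAdm R g p) (hA : matchA M a m h (hM.le h hR hg) hg p = 0) :
    ∃ C : ℝ, ∀ t, R₁ + 1 ≤ t →
      ‖radY M a m p t‖ ≤ C * Real.exp (-(gam1 g * t)) ∧ ‖radY₁ M a m p t‖ ≤ C * Real.exp (-(gam1 g * t)) := by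
  have hR₁r : Kerr.rPlus M a < R₁ := by linarith [hM.le h hR hg]
  have hQc : ContinuousOn (radQ M a m p) (Ioi R₁) := (continuousOn_radQ h.le p).mono fun s hs ↦ hR₁r.trans hs
  have hsol := isSol2_recY h hR hg hM hp
  have hsolY : IsSol2 (radQ M a m p) (radY M a m p) (radY₁ M a m p) (Ioi R₁) :=
    (isSol2_radY (m := m) h.le p).mono fun s hs ↦ hR₁r.trans hs
  have ht₁ : R₁ < R₁ + 1 := by linarith
  obtain ⟨c, hc, hc'⟩ := hsol.exists_eq_smul_of_wronskian_eq_zero hQc hsolY ht₁ hA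
    (Or.inl (recY_ne_zero h hR hg hM hp ht₁))
  set C₀ := 3 * (1 + Real.sqrt g) * Real.exp (gam1 g * R₁)
  refine ⟨‖c‖ * C₀, fun t ht ↦ ?_⟩
  have htm : t ∈ Ioi R₁ := by simp only [mem_Ioi]; linarith
  obtain ⟨d0, d1⟩ := recY_decay h hR hg hM hp (t := t) (by linarith)
  constructor
  · rw [show radY M a m p t = c * recY M a m h (hM.le h hR hg) hg p t from hc htm, norm_mul, mul_assoc]
    exact mul_le_mul_of_nonneg_left d0 (norm_nonneg _)
  · rw [show radY₁ M a m p t = c * recY₁ M a m h (hM.le h hR hg) hg p t from hc' htm, norm_mul, mul_assoc]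
    exact mul_le_mul_of_nonneg_left d1 (norm_nonneg _)

/-! ### Continuity of the horizon-regular solution in the parameters -/

/-- `w ↦ G(r; w)` and `w ↦ G₁(r; w)` are entire. [folklore] -/
theorem differentiable_radG (r : ℝ) :
    Differentiable ℂ (fun w ↦ radG M a m w r) ∧ Differentiable ℂ (fun w ↦ radG₁ M a m w r) := by
  have hθ : Differentiable ℂ fun w ↦ radTheta M a m w r := by
    unfold radTheta horBeta; fun_prop
  have hG : Differentiable ℂ fun w ↦ radG M a m w r := by
    unfold radG radPhase
    exact (differentiable_const _).mul ((differentiable_const _).mul hθ).cexp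
  refine ⟨hG, ?_⟩
  unfold radG₁ radLogG radK
  exact hG.mul (by fun_prop)

/-- **Continuity of `p ↦ (y, y')(t; p)`** at every `p₀ ∈ horGood`, `t > r₊`. [cite: Hartman2002, Ch. V Thm. 2.1] -/
theorem continuousAt_radY (h : Kerr.IsSubextremal M a) {p₀ : ℂ × ℂ × ℂ} (hp₀ : p₀ ∈ horGood M a) {t : ℝ}
    (ht : Kerr.rPlus M a < t) :
    ContinuousAt (fun p ↦ radY M a m p t) p₀ ∧ ContinuousAt (fun p ↦ radY₁ M a m p t) p₀ := by
  set R : ℝ := radR p₀ + 1 with hR_def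
  have hR : 0 ≤ R := by have := radR_nonneg p₀; positivity
  have hP₀ : p₀ ∈ horBox R := by
    obtain ⟨h1, h2, h3⟩ := mem_horBoxClosed_radR p₀
    exact ⟨by linarith, by linarith, by linarith⟩
  have hev : ∀ᶠ p in 𝓝 p₀, p ∈ horGood M a ∩ horBox R :=
    ((isOpen_horGood M a).inter (isOpen_horBox R)).mem_nhds ⟨hp₀, hP₀⟩
  have hρ := horRho_pos h hR
  set t₁ : ℝ := Kerr.rPlus M a + horRho M a R / 4 with ht₁
  have ht₁I : t₁ ∈ Ioo (Kerr.rPlus M a) (Kerr.rPlus M a + horRho M a R / 2) := by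
    simp only [ht₁]; constructor <;> linarith
  have hx₁ : ‖((t₁ : ℂ) - Kerr.rPlus M a)‖ < horRho M a R / 2 := by
    rw [← Complex.ofReal_sub, Complex.norm_real, Real.norm_eq_abs, abs_lt]; simp only [ht₁]; constructor <;> linarith
  set A : ℝ := min t t₁ with hA
  set B : ℝ := max t t₁ with hB
  have hAB : Icc A B ⊆ Ioi (Kerr.rPlus M a) := fun s hs ↦ lt_of_lt_of_le (lt_min ht ht₁I.1) hs.1
  have ht₁AB : t₁ ∈ Icc A B := ⟨min_le_right _ _, le_max_right _ _⟩
  have htAB : t ∈ Icc A B := ⟨min_le_left _ _, le_max_left _ _⟩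
  obtain ⟨hcU, hcU₁⟩ := contDiffOn_horFun_param h m hR hx₁ (n := 0) (by exact_mod_cast le_top)
  have hnb : horGood M a ∩ horBox R ∈ 𝓝 p₀ := hev
  obtain ⟨hGd, hG₁d⟩ := differentiable_radG (M := M) (a := a) (m := m) t₁
  have hdata0 : ContinuousAt (fun p ↦ radY M a m p t₁) p₀ := by
    have hc : ContinuousAt (fun p : ℂ × ℂ × ℂ ↦ radG M a m p.1 t₁ * horFun M a m p ((t₁ : ℂ) - Kerr.rPlus M a)) p₀ :=
      ((hGd.continuous.continuousAt).comp continuousAt_fst).mul (hcU.continuousOn.continuousAt hnb)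
    refine hc.congr ?_
    filter_upwards [hev] with p hp
    rw [(radY_eq_loc (m := m) h hR hp.1 (horBox_subset_horBoxClosed R hp.2) ht₁I).1]; rfl
  have hdata1 : ContinuousAt (fun p ↦ radY₁ M a m p t₁) p₀ := by
    have hc : ContinuousAt (fun p : ℂ × ℂ × ℂ ↦ radG₁ M a m p.1 t₁ * horFun M a m p ((t₁ : ℂ) - Kerr.rPlus M a) +
        radG M a m p.1 t₁ * horDer M a m R p ((t₁ : ℂ) - Kerr.rPlus M a)) p₀ :=
      (((hG₁d.continuous.continuousAt).comp continuousAt_fst).mul (hcU.continuousOn.continuousAt hnb)).add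
        (((hGd.continuous.continuousAt).comp continuousAt_fst).mul (hcU₁.continuousOn.continuousAt hnb))
    refine hc.congr ?_
    filter_upwards [hev] with p hp
    rw [(radY_eq_loc (m := m) h hR hp.1 (horBox_subset_horBoxClosed R hp.2) ht₁I).2]; rfl
  have hsol : ∀ p, IsSol2 (fun t ↦ ∑ i, radMon i p * radH M a m i t) (radY M a m p) (radY₁ M a m p) (Ioi (Kerr.rPlus M a)) :=
    fun p ↦ (isSol2_radY (m := m) h.le p).congr_coeff fun t ht ↦ radQ_eq_sum h.le p ht
  have hU := tendstoUniformlyOn_param_of_data hAB ht₁AB (fun i ↦ (contDiff_radMon i).continuous.continuousAt)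
    (fun i ↦ continuousOn_radH h.le i) hsol hdata0 hdata1 (p₀ := p₀)
  have key := (Metric.tendstoUniformlyOn_iff.1 hU)
  constructor
  · rw [Metric.continuousAt_iff']
    intro ε hε
    filter_upwards [key ε hε] with p hp
    have := hp t htAB
    rw [Prod.dist_eq, max_lt_iff] at this
    rw [dist_comm]; exact this.1
  · rw [Metric.continuousAt_iff']
    intro ε hε
    filter_upwards [key ε hε] with p hp
    have := hp t htAB
    rw [Prod.dist_eq, max_lt_iff] at this
    rw [dist_comm]; exact this.2

/-- **Continuity of the recessive pair in `p`** at admissible `p₀`. [folklore] -/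
theorem continuousAt_recY (h : Kerr.IsSubextremal M a) {R g R₁ : ℝ} (hR : 0 ≤ R) (hg : 0 < g)
    (hM : IsMatchRadius M a m R g R₁) {p₀ : ℂ × ℂ × ℂ} (hp₀ : IsAdm R g p₀) (t : ℝ) :
    ContinuousAt (fun p ↦ recY M a m h (hM.le h hR hg) hg p t) p₀ ∧
      ContinuousAt (fun p ↦ recY₁ M a m h (hM.le h hR hg) hg p t) p₀ := by
  obtain ⟨-, hw, -⟩ := norm_jostW_lt h hR hg hM hp₀
  have hwf : ContDiffAt ℂ 0 (jostW h m (hM.le h hR hg) g) p₀ := (contDiff_jostW h m _ g).contDiffAt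
  exact ⟨(contDiffAt_jostY_param (gam1_nonneg g) (gam1_lt hg) R₁ hwf hw t).continuousAt,
    (contDiffAt_jostYder_param (gam1_nonneg g) (gam1_lt hg) R₁ hwf hw t).continuousAt⟩

/-- **Continuity of the matching function** at admissible `p₀ ∈ horGood`. [folklore] -/
theorem continuousAt_matchA (h : Kerr.IsSubextremal M a) {R g R₁ : ℝ} (hR : 0 ≤ R) (hg : 0 < g)
    (hM : IsMatchRadius M a m R g R₁) {p₀ : ℂ × ℂ × ℂ} (hp₀ : IsAdm R g p₀) (hg₀ : p₀ ∈ horGood M a) :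
    ContinuousAt (matchA M a m h (hM.le h hR hg) hg) p₀ := by
  obtain ⟨c0, c1⟩ := continuousAt_recY h hR hg hM hp₀ (R₁ + 1)
  obtain ⟨d0, d1⟩ := continuousAt_radY (m := m) h hg₀ (t := R₁ + 1) (by linarith [hM.le h hR hg])
  unfold matchA wronskian
  exact (c0.mul d1).sub (c1.mul d0)

/-! ### Holomorphy of the matching function along holomorphic curves -/

/-- **Holomorphy of `κ ↦ (y, y')(t; P(κ))`** along a differentiable curve `P` in the parameter space
(at `κ₀` with `P(κ₀) ∈ horGood`). [cite: Hartman2002, Ch. V Thm. 3.1] -/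
theorem differentiableAt_radY_comp (h : Kerr.IsSubextremal M a) {P : ℂ → ℂ × ℂ × ℂ} {κ₀ : ℂ}
    (hP : DifferentiableAt ℂ P κ₀) (hp₀ : P κ₀ ∈ horGood M a) {t : ℝ} (ht : Kerr.rPlus M a < t) :
    DifferentiableAt ℂ (fun κ ↦ radY M a m (P κ) t) κ₀ ∧ DifferentiableAt ℂ (fun κ ↦ radY₁ M a m (P κ) t) κ₀ := by
  set p₀ := P κ₀ with hp₀_def
  set R : ℝ := radR p₀ + 1 with hR_def
  have hR : 0 ≤ R := by have := radR_nonneg p₀; positivity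
  have hP₀ : p₀ ∈ horBox R := by
    obtain ⟨h1, h2, h3⟩ := mem_horBoxClosed_radR p₀
    exact ⟨by linarith, by linarith, by linarith⟩
  have hnb : horGood M a ∩ horBox R ∈ 𝓝 p₀ := ((isOpen_horGood M a).inter (isOpen_horBox R)).mem_nhds ⟨hp₀, hP₀⟩
  have hev : ∀ᶠ κ in 𝓝 κ₀, P κ ∈ horGood M a ∩ horBox R := hP.continuousAt.preimage_mem_nhds hnb
  have hρ := horRho_pos h hR
  set t₁ : ℝ := Kerr.rPlus M a + horRho M a R / 4 with ht₁
  have ht₁I : t₁ ∈ Ioo (Kerr.rPlus M a) (Kerr.rPlus M a + horRho M a R / 2) := by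
    simp only [ht₁]; constructor <;> linarith
  have hx₁ : ‖((t₁ : ℂ) - Kerr.rPlus M a)‖ < horRho M a R / 2 := by
    rw [← Complex.ofReal_sub, Complex.norm_real, Real.norm_eq_abs, abs_lt]; simp only [ht₁]; constructor <;> linarith
  set A : ℝ := min t t₁
  set B : ℝ := max t t₁
  have hAB : Icc A B ⊆ Ioi (Kerr.rPlus M a) := fun s hs ↦ lt_of_lt_of_le (lt_min ht ht₁I.1) hs.1
  have ht₁AB : t₁ ∈ Icc A B := ⟨min_le_right _ _, le_max_right _ _⟩
  have htAB : t ∈ Icc A B := ⟨min_le_left _ _, le_max_left _ _⟩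
  obtain ⟨hcU, hcU₁⟩ := contDiffOn_horFun_param h m hR hx₁ (n := 1) (by exact_mod_cast le_top)
  have hU : DifferentiableAt ℂ (fun p : ℂ × ℂ × ℂ ↦ horFun M a m p ((t₁ : ℂ) - Kerr.rPlus M a)) p₀ :=
    (hcU.differentiableOn one_ne_zero).differentiableAt hnb
  have hU₁ : DifferentiableAt ℂ (fun p : ℂ × ℂ × ℂ ↦ horDer M a m R p ((t₁ : ℂ) - Kerr.rPlus M a)) p₀ :=
    (hcU₁.differentiableOn one_ne_zero).differentiableAt hnb
  obtain ⟨hGd, hG₁d⟩ := differentiable_radG (M := M) (a := a) (m := m) t₁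
  have h1 : DifferentiableAt ℂ (fun κ ↦ (P κ).1) κ₀ := differentiableAt_fst.comp κ₀ hP
  have hdata0 : DifferentiableAt ℂ (fun κ ↦ radY M a m (P κ) t₁) κ₀ := by
    have hd : DifferentiableAt ℂ (fun κ ↦ radG M a m (P κ).1 t₁ * horFun M a m (P κ) ((t₁ : ℂ) - Kerr.rPlus M a)) κ₀ :=
      ((hGd.differentiableAt).comp κ₀ h1).mul (hU.comp κ₀ hP)
    refine hd.congr_of_eventuallyEq ?_
    filter_upwards [hev] with κ hκ
    rw [(radY_eq_loc (m := m) h hR hκ.1 (horBox_subset_horBoxClosed R hκ.2) ht₁I).1]; rfl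
  have hdata1 : DifferentiableAt ℂ (fun κ ↦ radY₁ M a m (P κ) t₁) κ₀ := by
    have hd : DifferentiableAt ℂ (fun κ ↦ radG₁ M a m (P κ).1 t₁ * horFun M a m (P κ) ((t₁ : ℂ) - Kerr.rPlus M a) +
        radG M a m (P κ).1 t₁ * horDer M a m R (P κ) ((t₁ : ℂ) - Kerr.rPlus M a)) κ₀ :=
      (((hG₁d.differentiableAt).comp κ₀ h1).mul (hU.comp κ₀ hP)).add
        (((hGd.differentiableAt).comp κ₀ h1).mul (hU₁.comp κ₀ hP))
    refine hd.congr_of_eventuallyEq ?_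
    filter_upwards [hev] with κ hκ
    rw [(radY_eq_loc (m := m) h hR hκ.1 (horBox_subset_horBoxClosed R hκ.2) ht₁I).2]; rfl
  have hsol : ∀ κ, IsSol2 (fun t ↦ ∑ i, radMon i (P κ) * radH M a m i t) (radY M a m (P κ)) (radY₁ M a m (P κ))
      (Ioi (Kerr.rPlus M a)) := fun κ ↦ (isSol2_radY (m := m) h.le (P κ)).congr_coeff fun t ht ↦ radQ_eq_sum h.le (P κ) ht
  have hg : ∀ i, HasDerivAt (fun κ ↦ radMon i (P κ)) (deriv (fun κ ↦ radMon i (P κ)) κ₀) κ₀ := fun i ↦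
    ((((contDiff_radMon i).differentiable (by simp)).differentiableAt).comp κ₀ hP).hasDerivAt
  exact differentiableAt_param_of_data hAB ht₁AB hg (fun i ↦ continuousOn_radH h.le i) hsol hdata0 hdata1 htAB

/-- **Holomorphy of the matching function along a `C¹` (over `ℂ`) curve** `P` with `P(κ₀)`
admissible and in `horGood`. [cite: ShlapentokhRothman2014KleinGordon, §4.3 (holomorphy in ω)] -/
theorem differentiableAt_matchA_comp (h : Kerr.IsSubextremal M a) {R g R₁ : ℝ} (hR : 0 ≤ R) (hg : 0 < g)
    (hM : IsMatchRadius M a m R g R₁) {P : ℂ → ℂ × ℂ × ℂ} {κ₀ : ℂ} (hP : ContDiffAt ℂ 1 P κ₀)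
    (hp₀ : IsAdm R g (P κ₀)) (hg₀ : P κ₀ ∈ horGood M a) :
    DifferentiableAt ℂ (fun κ ↦ matchA M a m h (hM.le h hR hg) hg (P κ)) κ₀ := by
  obtain ⟨-, hw, -⟩ := norm_jostW_lt h hR hg hM hp₀
  have hwf : ContDiffAt ℂ 1 (fun κ ↦ jostW h m (hM.le h hR hg) g (P κ)) κ₀ :=
    (contDiff_jostW h m _ g).contDiffAt.comp κ₀ hP
  have c0 := (contDiffAt_jostY_param (gam1_nonneg g) (gam1_lt hg) R₁ hwf hw (R₁ + 1)).differentiableAt one_ne_zero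
  have c1 := (contDiffAt_jostYder_param (gam1_nonneg g) (gam1_lt hg) R₁ hwf hw (R₁ + 1)).differentiableAt one_ne_zero
  obtain ⟨d0, d1⟩ := differentiableAt_radY_comp (m := m) h (hP.differentiableAt one_ne_zero) hg₀ (t := R₁ + 1)
    (by linarith [hM.le h hR hg])
  unfold matchA wronskian
  exact (c0.mul d1).sub (c1.mul d0)

/-! ### The horizon/infinity current identity for real parameters -/

/-- **The current identity.** For real admissible `p = (w, Λ, σ)`:
`im(𝔞(p) · conj(y_rec(t₁) y(t₁))) = (am − 2Mwr₊) ‖y_rec(t₁)‖²`, `t₁ = R₁ + 1` — the horizon current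
`im(y'ȳ) = am − 2Mwr₊` of the horizon-regular solution against the vanishing current of the
recessive one (`Q` real, `y_rec → 0`). Consequently real zeros of `𝔞` occur only at `w = ω₀`.
[cite: ShlapentokhRothman2014KleinGordon, §3 (energy identity) and §4.3] -/
theorem im_matchA_mul_conj (h : Kerr.IsSubextremal M a) {R g R₁ : ℝ} (hR : 0 ≤ R) (hg : 0 < g)
    (hM : IsMatchRadius M a m R g R₁) (w Λ σ : ℝ) (hp : IsAdm R g ((w : ℂ), (Λ : ℂ), (σ : ℂ))) :
    (matchA M a m h (hM.le h hR hg) hg ((w : ℂ), (Λ : ℂ), (σ : ℂ)) *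
        conj (recY M a m h (hM.le h hR hg) hg ((w : ℂ), (Λ : ℂ), (σ : ℂ)) (R₁ + 1) * radY M a m ((w : ℂ), (Λ : ℂ), (σ : ℂ)) (R₁ + 1))).im =
      (a * m - 2 * M * w * Kerr.rPlus M a) * ‖recY M a m h (hM.le h hR hg) hg ((w : ℂ), (Λ : ℂ), (σ : ℂ)) (R₁ + 1)‖ ^ 2 := by
  set p : ℂ × ℂ × ℂ := ((w : ℂ), (Λ : ℂ), (σ : ℂ)) with hp_def
  set y := recY M a m h (hM.le h hR hg) hg p with hy
  set y₁ := recY₁ M a m h (hM.le h hR hg) hg p with hy₁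
  set t₁ := R₁ + 1 with ht₁
  have hsol : IsSol2 (radQ M a m p) y y₁ (Ioi R₁) := isSol2_recY h hR hg hM hp
  have hR₁r : Kerr.rPlus M a < R₁ := by linarith [hM.le h hR hg]
  -- (1) the current of the recessive solution vanishes on `(R₁, ∞)`
  set J : ℝ → ℝ := fun t ↦ (y₁ t * conj (y t)).im with hJ
  have hJd : ∀ t ∈ Ioi R₁, HasDerivAt J 0 t := by
    intro t ht
    have := hasDerivAt_im_mul_conj hsol ht
    rw [hp_def, im_radQ_ofReal, zero_mul] at this
    exact this
  have hJconst : ∀ s ∈ Ioi R₁, ∀ t ∈ Ioi R₁, J s = J t := fun s hs t ht ↦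
    isOpen_Ioi.is_const_of_deriv_eq_zero isPreconnected_Ioi
      (fun x hx ↦ (hJd x hx).differentiableAt.differentiableWithinAt) (fun x hx ↦ (hJd x hx).deriv) hs ht
  have hJlim : Tendsto J atTop (𝓝 0) := by
    have hb : ∀ᶠ t in atTop, ‖J t‖ ≤ (3 * (1 + Real.sqrt g) * Real.exp (gam1 g * R₁)) ^ 2 * Real.exp (-((gam1 g + gam1 g) * t)) := by
      filter_upwards [eventually_ge_atTop R₁] with t ht
      obtain ⟨d0, d1⟩ := recY_decay h hR hg hM hp ht
      rw [Real.norm_eq_abs]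
      calc |J t| ≤ ‖y₁ t * conj (y t)‖ := Complex.abs_im_le_norm _
        _ = ‖y₁ t‖ * ‖y t‖ := by rw [norm_mul, Complex.norm_conj]
        _ ≤ (3 * (1 + Real.sqrt g) * Real.exp (gam1 g * R₁) * Real.exp (-(gam1 g * t))) *
            (3 * (1 + Real.sqrt g) * Real.exp (gam1 g * R₁) * Real.exp (-(gam1 g * t))) :=
            mul_le_mul d1 d0 (norm_nonneg _) (by positivity)
        _ = _ := by rw [show -((gam1 g + gam1 g) * t) = -(gam1 g * t) + -(gam1 g * t) by ring, Real.exp_add]; ring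
    have hlim : Tendsto (fun t ↦ (3 * (1 + Real.sqrt g) * Real.exp (gam1 g * R₁)) ^ 2 * Real.exp (-((gam1 g + gam1 g) * t)))
        atTop (𝓝 0) := by
      have hpos : 0 < gam1 g + gam1 g := by
        have := Real.sqrt_pos.2 hg; unfold gam1; positivity
      have : Tendsto (fun t ↦ Real.exp (-((gam1 g + gam1 g) * t))) atTop (𝓝 0) := by
        have h1 := Real.tendsto_exp_neg_atTop_nhds_zero.comp (tendsto_id.const_mul_atTop hpos)
        simpa [Function.comp_def] using h1
      simpa using this.const_mul ((3 * (1 + Real.sqrt g) * Real.exp (gam1 g * R₁)) ^ 2)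
    exact squeeze_zero_norm' hb hlim
  have hJ0 : J t₁ = 0 := by
    have ht₁m : t₁ ∈ Ioi R₁ := by simp only [ht₁, mem_Ioi]; linarith
    have hlim2 : Tendsto J atTop (𝓝 (J t₁)) := by
      refine (tendsto_const_nhds).congr' ?_
      filter_upwards [eventually_gt_atTop R₁] with t ht using hJconst t₁ ht₁m t ht
    exact tendsto_nhds_unique hlim2 hJlim
  -- (2) the horizon current
  have hH := im_radY₁_mul_conj (m := m) h w Λ σ (r := t₁) (by simp only [ht₁]; linarith)
  rw [← hp_def] at hH
  -- (3) algebra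
  have e1 : y t₁ * conj (y t₁) = ((‖y t₁‖ ^ 2 : ℝ) : ℂ) := by rw [Complex.mul_conj, Complex.normSq_eq_norm_sq]
  have e2 : radY M a m p t₁ * conj (radY M a m p t₁) = ((‖radY M a m p t₁‖ ^ 2 : ℝ) : ℂ) := by
    rw [Complex.mul_conj, Complex.normSq_eq_norm_sq]
  have key : matchA M a m h (hM.le h hR hg) hg p * conj (y t₁ * radY M a m p t₁) =
      ((‖y t₁‖ ^ 2 : ℝ) : ℂ) * (radY₁ M a m p t₁ * conj (radY M a m p t₁)) -
        ((‖radY M a m p t₁‖ ^ 2 : ℝ) : ℂ) * (y₁ t₁ * conj (y t₁)) := by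
    rw [← e1, ← e2, matchA, wronskian, map_mul]
    simp only [← hy, ← hy₁, ← ht₁]
    ring
  rw [key, Complex.sub_im, Complex.im_ofReal_mul, Complex.im_ofReal_mul, hH]
  have : (y₁ t₁ * conj (y t₁)).im = 0 := hJ0
  rw [this, mul_zero, sub_zero, mul_comm]

/-- **Real zeros of the matching function are at threshold**: for real admissible `p = (w, Λ, σ)`
with `𝔞(p) = 0`, `am − 2Mwr₊ = 0`. [cite: ShlapentokhRothman2014KleinGordon, Thm. 1.3 / §3] -/
theorem am_sub_eq_zero_of_matchA_eq_zero (h : Kerr.IsSubextremal M a) {R g R₁ : ℝ} (hR : 0 ≤ R) (hg : 0 < g)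
    (hM : IsMatchRadius M a m R g R₁) (w Λ σ : ℝ) (hp : IsAdm R g ((w : ℂ), (Λ : ℂ), (σ : ℂ)))
    (hA : matchA M a m h (hM.le h hR hg) hg ((w : ℂ), (Λ : ℂ), (σ : ℂ)) = 0) :
    a * m - 2 * M * w * Kerr.rPlus M a = 0 := by
  have h1 := im_matchA_mul_conj h hR hg hM w Λ σ hp
  rw [hA, zero_mul, Complex.zero_im] at h1
  have hne : ‖recY M a m h (hM.le h hR hg) hg ((w : ℂ), (Λ : ℂ), (σ : ℂ)) (R₁ + 1)‖ ^ 2 ≠ 0 :=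
    pow_ne_zero 2 (norm_ne_zero_iff.2 (recY_ne_zero h hR hg hM hp (by linarith)))
  exact (mul_eq_zero.1 h1.symm).resolve_right hne

end MatchFn

end Literature.Barriers.FinalStateConjecture
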